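import Literature.AnabelianGeometry.SemiGraphs.TemperedCompactInVerticialAtOfFixedSystems
import Literature.AnabelianGeometry.SemiGraphs.TemperedFixedGeodesicsBoundedAssembly
import Literature.AnabelianGeometry.SemiGraphs.TemperedCompactFixedSystemsBaire
import HarnessLib

/-!
# [SemiAnbd] Thm. 3.7 (iii) / Cor. 3.9 at a countable `𝒢` from the «no escape» bounds

Mochizuki, *Semi-graphs of anabelioids*, Publ. RIMS **42** (2006), §3, Theorem 3.7 (iii) pp. 40–41 and
Corollary 3.9 p. 42 [cite: MochizukiSemiAnbd2006, Thm 3.7(iii) pp.40-41].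

PROOF-ONLY closer (cell abc-iut, layer L3, GAP row G-t6g3-2 «Thm 3.7 (iii)/Cor 3.9 beyond finite 𝒢»; seat
abc-iut-L3-t10, integrator; no definition).  The whole kernel reduction of this row in two theorems.
`compactInVerticialAt_of_fixedSystems` (abc-iut-w4-d083) derives `CompactInVerticialAt 𝒢` from the
input (FIX∞) = (`Hfix`, `Hadj`) at the canonical level data `verticialLevelData_temperedPiChart`; here
both clauses are supplied from METRIC BOUNDS on that data — print's implicit "since the semi-graphs `𝔾_j`
are all finite" (p. 41) replaced by what the argument actually needs at an infinite countable `𝔾`: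

* `Hfix` ⟸ (`hdisp`) for every nontrivial compact `C` there is a compatible base system of tree vertices
  along which each element of `C` has bounded displacement (abc-iut-L3-t6's
  `exists_fixedSystem_of_pointwise_bdd`: Baire on `↥C`, orbit lemma, nearest fixed points);
* `Hadj` ⟸ (`hbdd`) two compatible `C`-fixed vertex systems stay at bounded subdivision distance
  (`hadj_temperedPiChart_of_bounded_dist`: abc-iut-w5-d160's bounded geodesics, the subjoint kill, and
  the compact-form branch-level identification (I4′)_cpt at the orbit-graph levels `stabC`, produced by
  the Galois tower — abc-iut-L3-t11's `stabBranchPairCpt'_ofTower'`).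

`compactInVerticialAt_of_displacement_bounds` and `cor39UpToTwistAt_of_displacement_bounds` therefore
leave EXACTLY the open sub-row G-t6g3-2b («no escape»: `hdisp`, `hbdd`) and the tower's (I4′)_cpt as
binders; at finite `𝔾` all three are theorems of the tree.  The test semi-graph `𝒢⋆` of abc-iut-w4-d075
satisfies `hdisp`/`hbdd` desk-side; nothing false is asserted there.

Nothing here takes a side on [IUTchIII] Cor. 3.12.
-/

namespace Literature.AnabelianGeometry.SemiGraphs

namespace ProfiniteSemiGraph

open CategoryTheory Topology

universe u

variable {𝒢 : ProfiniteSemiGraph.{u}}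

/-- **Theorem 3.7 (iii) AT a countable `𝒢` from displacement bounds** ([SemiAnbd] pp. 40–41):
modulo (I4′)_cpt at the orbit-graph levels of the Galois tower (`stabC`), bounded displacement of the
elements of every nontrivial compact subgroup along some compatible base system (`hdisp`) and bounded
distance of compatible fixed pairs (`hbdd`), every compact subgroup of `π₁^temp(𝒢)` lies in a verticial
subgroup, and a nontrivial one lying in two distinct verticial subgroups lies in precisely those two and
in an edge-like subgroup of a closed edge — for EVERY chart, with no finiteness of `𝒢`.
[cite: MochizukiSemiAnbd2006, Thm 3.7(iii) pp.40-41] -/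
theorem compactInVerticialAt_of_displacement_bounds (h37 : 𝒢.Thm37Hypotheses)
    (stabC : ∀ (C : Subgroup (𝒢.temperedPiChart h37.toProp36Hypotheses).G),
      IsCompact (C : Set (𝒢.temperedPiChart h37.toProp36Hypotheses).G) →
      ∀ (j₀ : ℕ) (w : ∀ i : {i : ℕ // j₀ ≤ i}, ((𝒢.galoisLevelData h37.toProp36Hypotheses).S i.1).orbitGraph.Vertex)
      (β β' : ∀ i : {i : ℕ // j₀ ≤ i}, ((𝒢.galoisLevelData h37.toProp36Hypotheses).S i.1).orbitGraph.Branch),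
      (∀ i, β i ≠ β' i ∧ ((𝒢.galoisLevelData h37.toProp36Hypotheses).S i.1).orbitGraph.abuts (β i) = some (w i) ∧
        ((𝒢.galoisLevelData h37.toProp36Hypotheses).S i.1).orbitGraph.abuts (β' i) = some (w i)) →
      (∀ ⦃i i' : {i : ℕ // j₀ ≤ i}⦄ (h : i.1 ≤ i'.1), ((𝒢.galoisLevelData h37.toProp36Hypotheses).levelTrans h).vertexMap (w i') = w i ∧
        ((𝒢.galoisLevelData h37.toProp36Hypotheses).levelTrans h).branchMap (β i') = β i ∧ ((𝒢.galoisLevelData h37.toProp36Hypotheses).levelTrans h).branchMap (β' i') = β' i) →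
      ∃ (Q : Type u) (_ : Group Q) (ιQ : (𝒢.temperedPiChart h37.toProp36Hypotheses).G →* Q) (v : 𝒢.graph.Vertex)
        (b b' : 𝒢.graph.Branch) (hb : 𝒢.graph.abuts b = some v) (hb' : 𝒢.graph.abuts b' = some v)
        (ψ : 𝒢.Gv v →* Q) (y y' : 𝒢.Gv v),
        Set.InjOn ιQ C ∧ Function.Injective ψ ∧ (b' ≠ b ∨ y⁻¹ * y' ∉ 𝒢.branchSubgroup b v hb) ∧
        ∀ g ∈ C, (∀ i, ((𝒢.galoisLevelData h37.toProp36Hypotheses).levelAct h37.isCountable (𝒢.galoisLevelData_hconn h37.toProp36Hypotheses) i.1 g).hom.vertexMap (w i) = w i ∧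
          ((𝒢.galoisLevelData h37.toProp36Hypotheses).levelAct h37.isCountable (𝒢.galoisLevelData_hconn h37.toProp36Hypotheses) i.1 g).hom.branchMap (β i) = β i ∧
          ((𝒢.galoisLevelData h37.toProp36Hypotheses).levelAct h37.isCountable (𝒢.galoisLevelData_hconn h37.toProp36Hypotheses) i.1 g).hom.branchMap (β' i) = β' i) →
          ιQ g ∈ ((𝒢.branchSubgroup b v hb).map (MulAut.conj y).toMonoidHom).map ψ ⊓
            ((𝒢.branchSubgroup b' v hb').map (MulAut.conj y').toMonoidHom).map ψ)
    (hdisp : ∀ (C : Subgroup (𝒢.temperedPiChart h37.toProp36Hypotheses).G), IsCompact (C : Set (𝒢.temperedPiChart h37.toProp36Hypotheses).G) → C ≠ ⊥ →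
      ∃ x : ∀ j, ((verticialLevelData_temperedPiChart (h36 := h37.toProp36Hypotheses)).tree j).Vertex,
        (∀ ⦃i j : ℕ⦄ (hij : i ≤ j), ((verticialLevelData_temperedPiChart (h36 := h37.toProp36Hypotheses)).trans hij).vertexMap (x j) = x i) ∧
        ∀ g ∈ C, ∃ N : ℕ, ∀ j, ((verticialLevelData_temperedPiChart (h36 := h37.toProp36Hypotheses)).tree j).subdivision.dist (Sum.inl (x j))
          (Sum.inl (((verticialLevelData_temperedPiChart (h36 := h37.toProp36Hypotheses)).act j g).hom.vertexMap (x j))) ≤ N)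
    (hbdd : ∀ (C : Subgroup (𝒢.temperedPiChart h37.toProp36Hypotheses).G), IsCompact (C : Set (𝒢.temperedPiChart h37.toProp36Hypotheses).G) → C ≠ ⊥ →
      ∀ x x' : ∀ j, ((verticialLevelData_temperedPiChart (h36 := h37.toProp36Hypotheses)).tree j).Vertex,
      (∀ ⦃i j : ℕ⦄ (hij : i ≤ j), ((verticialLevelData_temperedPiChart (h36 := h37.toProp36Hypotheses)).trans hij).vertexMap (x j) = x i) →
      (∀ ⦃i j : ℕ⦄ (hij : i ≤ j), ((verticialLevelData_temperedPiChart (h36 := h37.toProp36Hypotheses)).trans hij).vertexMap (x' j) = x' i) →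
      (∀ g ∈ C, ∀ j, ((verticialLevelData_temperedPiChart (h36 := h37.toProp36Hypotheses)).act j g).hom.vertexMap (x j) = x j) →
      (∀ g ∈ C, ∀ j, ((verticialLevelData_temperedPiChart (h36 := h37.toProp36Hypotheses)).act j g).hom.vertexMap (x' j) = x' j) →
      ∃ N : ℕ, ∀ j, ((verticialLevelData_temperedPiChart (h36 := h37.toProp36Hypotheses)).tree j).subdivision.dist (Sum.inl (x j)) (Sum.inl (x' j)) ≤ N) :
    CompactInVerticialAt 𝒢 :=
  compactInVerticialAt_of_fixedSystems h37.toProp36Hypotheses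
    (fun C hC hC1 => by
      obtain ⟨x, hx, hpt⟩ := hdisp C hC hC1
      exact (verticialLevelData_temperedPiChart (h36 := h37.toProp36Hypotheses)).exists_fixedSystem_of_pointwise_bdd C hC x hx hpt)
    (fun C hC hC1 x x' hx hx' hfx hfx' j hne =>
      hadj_temperedPiChart_of_bounded_dist h37 stabC C hC hC1 x x' hx hx' hfx hfx'
        (hbdd C hC hC1 x x' hx hx' hfx hfx') j hne)

/-- **Corollary 3.9 (up to twist) for a pair of countable graphs of anabelioids from displacement
bounds at both** ([SemiAnbd] p. 42): the per-pair assembly through `cor39UpToTwistAt_of_fixedSystems`,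
each (FIX∞) supplied as in `compactInVerticialAt_of_displacement_bounds`.
[cite: MochizukiSemiAnbd2006, Cor 3.9 p.42] -/
theorem cor39UpToTwistAt_of_displacement_bounds {ℋ : ProfiniteSemiGraph.{u}}
    (h37𝒢 : 𝒢.Thm37Hypotheses) (h37ℋ : ℋ.Thm37Hypotheses)
    (stabC𝒢 : ∀ (C : Subgroup (𝒢.temperedPiChart h37𝒢.toProp36Hypotheses).G),
      IsCompact (C : Set (𝒢.temperedPiChart h37𝒢.toProp36Hypotheses).G) →
      ∀ (j₀ : ℕ) (w : ∀ i : {i : ℕ // j₀ ≤ i}, ((𝒢.galoisLevelData h37𝒢.toProp36Hypotheses).S i.1).orbitGraph.Vertex)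
      (β β' : ∀ i : {i : ℕ // j₀ ≤ i}, ((𝒢.galoisLevelData h37𝒢.toProp36Hypotheses).S i.1).orbitGraph.Branch),
      (∀ i, β i ≠ β' i ∧ ((𝒢.galoisLevelData h37𝒢.toProp36Hypotheses).S i.1).orbitGraph.abuts (β i) = some (w i) ∧
        ((𝒢.galoisLevelData h37𝒢.toProp36Hypotheses).S i.1).orbitGraph.abuts (β' i) = some (w i)) →
      (∀ ⦃i i' : {i : ℕ // j₀ ≤ i}⦄ (h : i.1 ≤ i'.1), ((𝒢.galoisLevelData h37𝒢.toProp36Hypotheses).levelTrans h).vertexMap (w i') = w i ∧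
        ((𝒢.galoisLevelData h37𝒢.toProp36Hypotheses).levelTrans h).branchMap (β i') = β i ∧ ((𝒢.galoisLevelData h37𝒢.toProp36Hypotheses).levelTrans h).branchMap (β' i') = β' i) →
      ∃ (Q : Type u) (_ : Group Q) (ιQ : (𝒢.temperedPiChart h37𝒢.toProp36Hypotheses).G →* Q) (v : 𝒢.graph.Vertex)
        (b b' : 𝒢.graph.Branch) (hb : 𝒢.graph.abuts b = some v) (hb' : 𝒢.graph.abuts b' = some v)
        (ψ : 𝒢.Gv v →* Q) (y y' : 𝒢.Gv v),
        Set.InjOn ιQ C ∧ Function.Injective ψ ∧ (b' ≠ b ∨ y⁻¹ * y' ∉ 𝒢.branchSubgroup b v hb) ∧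
        ∀ g ∈ C, (∀ i, ((𝒢.galoisLevelData h37𝒢.toProp36Hypotheses).levelAct h37𝒢.isCountable (𝒢.galoisLevelData_hconn h37𝒢.toProp36Hypotheses) i.1 g).hom.vertexMap (w i) = w i ∧
          ((𝒢.galoisLevelData h37𝒢.toProp36Hypotheses).levelAct h37𝒢.isCountable (𝒢.galoisLevelData_hconn h37𝒢.toProp36Hypotheses) i.1 g).hom.branchMap (β i) = β i ∧
          ((𝒢.galoisLevelData h37𝒢.toProp36Hypotheses).levelAct h37𝒢.isCountable (𝒢.galoisLevelData_hconn h37𝒢.toProp36Hypotheses) i.1 g).hom.branchMap (β' i) = β' i) →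
          ιQ g ∈ ((𝒢.branchSubgroup b v hb).map (MulAut.conj y).toMonoidHom).map ψ ⊓
            ((𝒢.branchSubgroup b' v hb').map (MulAut.conj y').toMonoidHom).map ψ)
    (hdisp𝒢 : ∀ (C : Subgroup (𝒢.temperedPiChart h37𝒢.toProp36Hypotheses).G), IsCompact (C : Set (𝒢.temperedPiChart h37𝒢.toProp36Hypotheses).G) → C ≠ ⊥ →
      ∃ x : ∀ j, ((verticialLevelData_temperedPiChart (h36 := h37𝒢.toProp36Hypotheses)).tree j).Vertex,
        (∀ ⦃i j : ℕ⦄ (hij : i ≤ j), ((verticialLevelData_temperedPiChart (h36 := h37𝒢.toProp36Hypotheses)).trans hij).vertexMap (x j) = x i) ∧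
        ∀ g ∈ C, ∃ N : ℕ, ∀ j, ((verticialLevelData_temperedPiChart (h36 := h37𝒢.toProp36Hypotheses)).tree j).subdivision.dist (Sum.inl (x j))
          (Sum.inl (((verticialLevelData_temperedPiChart (h36 := h37𝒢.toProp36Hypotheses)).act j g).hom.vertexMap (x j))) ≤ N)
    (hbdd𝒢 : ∀ (C : Subgroup (𝒢.temperedPiChart h37𝒢.toProp36Hypotheses).G), IsCompact (C : Set (𝒢.temperedPiChart h37𝒢.toProp36Hypotheses).G) → C ≠ ⊥ →
      ∀ x x' : ∀ j, ((verticialLevelData_temperedPiChart (h36 := h37𝒢.toProp36Hypotheses)).tree j).Vertex,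
      (∀ ⦃i j : ℕ⦄ (hij : i ≤ j), ((verticialLevelData_temperedPiChart (h36 := h37𝒢.toProp36Hypotheses)).trans hij).vertexMap (x j) = x i) →
      (∀ ⦃i j : ℕ⦄ (hij : i ≤ j), ((verticialLevelData_temperedPiChart (h36 := h37𝒢.toProp36Hypotheses)).trans hij).vertexMap (x' j) = x' i) →
      (∀ g ∈ C, ∀ j, ((verticialLevelData_temperedPiChart (h36 := h37𝒢.toProp36Hypotheses)).act j g).hom.vertexMap (x j) = x j) →
      (∀ g ∈ C, ∀ j, ((verticialLevelData_temperedPiChart (h36 := h37𝒢.toProp36Hypotheses)).act j g).hom.vertexMap (x' j) = x' j) →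
      ∃ N : ℕ, ∀ j, ((verticialLevelData_temperedPiChart (h36 := h37𝒢.toProp36Hypotheses)).tree j).subdivision.dist (Sum.inl (x j)) (Sum.inl (x' j)) ≤ N)
    (stabCℋ : ∀ (C : Subgroup (ℋ.temperedPiChart h37ℋ.toProp36Hypotheses).G),
      IsCompact (C : Set (ℋ.temperedPiChart h37ℋ.toProp36Hypotheses).G) →
      ∀ (j₀ : ℕ) (w : ∀ i : {i : ℕ // j₀ ≤ i}, ((ℋ.galoisLevelData h37ℋ.toProp36Hypotheses).S i.1).orbitGraph.Vertex)
      (β β' : ∀ i : {i : ℕ // j₀ ≤ i}, ((ℋ.galoisLevelData h37ℋ.toProp36Hypotheses).S i.1).orbitGraph.Branch),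
      (∀ i, β i ≠ β' i ∧ ((ℋ.galoisLevelData h37ℋ.toProp36Hypotheses).S i.1).orbitGraph.abuts (β i) = some (w i) ∧
        ((ℋ.galoisLevelData h37ℋ.toProp36Hypotheses).S i.1).orbitGraph.abuts (β' i) = some (w i)) →
      (∀ ⦃i i' : {i : ℕ // j₀ ≤ i}⦄ (h : i.1 ≤ i'.1), ((ℋ.galoisLevelData h37ℋ.toProp36Hypotheses).levelTrans h).vertexMap (w i') = w i ∧
        ((ℋ.galoisLevelData h37ℋ.toProp36Hypotheses).levelTrans h).branchMap (β i') = β i ∧ ((ℋ.galoisLevelData h37ℋ.toProp36Hypotheses).levelTrans h).branchMap (β' i') = β' i) →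
      ∃ (Q : Type u) (_ : Group Q) (ιQ : (ℋ.temperedPiChart h37ℋ.toProp36Hypotheses).G →* Q) (v : ℋ.graph.Vertex)
        (b b' : ℋ.graph.Branch) (hb : ℋ.graph.abuts b = some v) (hb' : ℋ.graph.abuts b' = some v)
        (ψ : ℋ.Gv v →* Q) (y y' : ℋ.Gv v),
        Set.InjOn ιQ C ∧ Function.Injective ψ ∧ (b' ≠ b ∨ y⁻¹ * y' ∉ ℋ.branchSubgroup b v hb) ∧
        ∀ g ∈ C, (∀ i, ((ℋ.galoisLevelData h37ℋ.toProp36Hypotheses).levelAct h37ℋ.isCountable (ℋ.galoisLevelData_hconn h37ℋ.toProp36Hypotheses) i.1 g).hom.vertexMap (w i) = w i ∧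
          ((ℋ.galoisLevelData h37ℋ.toProp36Hypotheses).levelAct h37ℋ.isCountable (ℋ.galoisLevelData_hconn h37ℋ.toProp36Hypotheses) i.1 g).hom.branchMap (β i) = β i ∧
          ((ℋ.galoisLevelData h37ℋ.toProp36Hypotheses).levelAct h37ℋ.isCountable (ℋ.galoisLevelData_hconn h37ℋ.toProp36Hypotheses) i.1 g).hom.branchMap (β' i) = β' i) →
          ιQ g ∈ ((ℋ.branchSubgroup b v hb).map (MulAut.conj y).toMonoidHom).map ψ ⊓
            ((ℋ.branchSubgroup b' v hb').map (MulAut.conj y').toMonoidHom).map ψ)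
    (hdispℋ : ∀ (C : Subgroup (ℋ.temperedPiChart h37ℋ.toProp36Hypotheses).G), IsCompact (C : Set (ℋ.temperedPiChart h37ℋ.toProp36Hypotheses).G) → C ≠ ⊥ →
      ∃ x : ∀ j, ((verticialLevelData_temperedPiChart (𝒢 := ℋ) (h36 := h37ℋ.toProp36Hypotheses)).tree j).Vertex,
        (∀ ⦃i j : ℕ⦄ (hij : i ≤ j), ((verticialLevelData_temperedPiChart (𝒢 := ℋ) (h36 := h37ℋ.toProp36Hypotheses)).trans hij).vertexMap (x j) = x i) ∧
        ∀ g ∈ C, ∃ N : ℕ, ∀ j, ((verticialLevelData_temperedPiChart (𝒢 := ℋ) (h36 := h37ℋ.toProp36Hypotheses)).tree j).subdivision.dist (Sum.inl (x j))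
          (Sum.inl (((verticialLevelData_temperedPiChart (𝒢 := ℋ) (h36 := h37ℋ.toProp36Hypotheses)).act j g).hom.vertexMap (x j))) ≤ N)
    (hbddℋ : ∀ (C : Subgroup (ℋ.temperedPiChart h37ℋ.toProp36Hypotheses).G), IsCompact (C : Set (ℋ.temperedPiChart h37ℋ.toProp36Hypotheses).G) → C ≠ ⊥ →
      ∀ x x' : ∀ j, ((verticialLevelData_temperedPiChart (𝒢 := ℋ) (h36 := h37ℋ.toProp36Hypotheses)).tree j).Vertex,
      (∀ ⦃i j : ℕ⦄ (hij : i ≤ j), ((verticialLevelData_temperedPiChart (𝒢 := ℋ) (h36 := h37ℋ.toProp36Hypotheses)).trans hij).vertexMap (x j) = x i) →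
      (∀ ⦃i j : ℕ⦄ (hij : i ≤ j), ((verticialLevelData_temperedPiChart (𝒢 := ℋ) (h36 := h37ℋ.toProp36Hypotheses)).trans hij).vertexMap (x' j) = x' i) →
      (∀ g ∈ C, ∀ j, ((verticialLevelData_temperedPiChart (𝒢 := ℋ) (h36 := h37ℋ.toProp36Hypotheses)).act j g).hom.vertexMap (x j) = x j) →
      (∀ g ∈ C, ∀ j, ((verticialLevelData_temperedPiChart (𝒢 := ℋ) (h36 := h37ℋ.toProp36Hypotheses)).act j g).hom.vertexMap (x' j) = x' j) →
      ∃ N : ℕ, ∀ j, ((verticialLevelData_temperedPiChart (𝒢 := ℋ) (h36 := h37ℋ.toProp36Hypotheses)).tree j).subdivision.dist (Sum.inl (x j)) (Sum.inl (x' j)) ≤ N)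
    (h𝒢 : Cor39Hypotheses 𝒢) (hℋ : Cor39Hypotheses ℋ) (c𝒢 : TemperedPiChart 𝒢) (cℋ : TemperedPiChart ℋ) :
    (∀ (F : Hom 𝒢 ℋ), F.IsLocallyOpen → ∀ φ : c𝒢.G →ₜ* cℋ.G,
        (∃ θ : F.ConjugatorFamily, Nonempty (F.chartPullbackWith θ c𝒢 cℋ ≅ BTemp.res φ)) →
          IsCompatiblyQuasiGeometric φ) ∧
      ∀ φ : c𝒢.G →ₜ* cℋ.G, IsCompatiblyQuasiGeometric φ →
        ∃ F : Hom 𝒢 ℋ, F.IsLocallyOpen ∧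
          (∃ θ : F.ConjugatorFamily, Nonempty (F.chartPullbackWith θ c𝒢 cℋ ≅ BTemp.res φ)) ∧
          ∀ F' : Hom 𝒢 ℋ, F'.IsLocallyOpen →
            (∃ θ' : F'.ConjugatorFamily, Nonempty (F'.chartPullbackWith θ' c𝒢 cℋ ≅ BTemp.res φ)) →
              F'.base.vertexMap = F.base.vertexMap ∧ F'.base.edgeMap = F.base.edgeMap :=
  cor39UpToTwistAt (compactInVerticialAt_of_displacement_bounds h37𝒢 stabC𝒢 hdisp𝒢 hbdd𝒢)
    (compactInVerticialAt_of_displacement_bounds h37ℋ stabCℋ hdispℋ hbddℋ) h𝒢 hℋ c𝒢 cℋ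

end ProfiniteSemiGraph

end Literature.AnabelianGeometry.SemiGraphs
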